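import Mathlib
import HarnessLib

/-!
# Venture HSemireg — the cubic form of the fibre test is a SEMI-INVARIANT of the diagonal scalings (weight `det(A)² · s_a s_b s_c`)

HONEST FRAMING. Lean leaf for the computation cell `pub-hsemireg` (target seat t-5 gen 24; file of record
`run/shared/lean/pub/pub-hsemireg/target-g6/REGIME-CENSUS-t5g24.md` §6). In the cell's fibre-test model a class `c` has potentials
`V^c_1, V^c_2, V^c_3` and components `B^c_i = u_{i-1} V^c_{i+1} + V^c_{i+1} u_{i-1}` (indices mod 3), and the cubic form of three classes is
`T = Σ_σ sgn σ · B^a_{σ1} B^b_{σ2} B^c_{σ3}` (six terms). th-3 g36's DEGENERATION LEMMA uses, and t-5 g24's instability certificates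
(REGIME-CENSUS §6, ROW (6)) rest on, the fact that `T` is a semi-invariant of the diagonal scalings
`u_l ↦ t_l • u_l`, `V^c_j ↦ (s_c t_j) • V^c_j`: then `B^c_i ↦ (s_c t_{i-1} t_{i+1}) • B^c_i` and `T ↦ (s_a s_b s_c (t_1 t_2 t_3)²) • T`, because
each of the six products uses every component index exactly once. THIS FILE kernel-checks exactly that bookkeeping in an arbitrary
(associative, unital) algebra `R` over a commutative ring `k` (conjugation by `Π GL(M_p)` is not modelled: it fixes every trace-like
functional anyway). Consequence used by the cell (not formalised here: it needs the matrix model and a limit/valuation argument): if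
integer exponents make every support entry of `(u; V^a, V^b, V^c)` scale by a POSITIVE power of `t` while `2Σf + σ_a+σ_b+σ_c = 0`, then
`str T = 0`. Nothing here proves (W³)₄; nothing here bears on HC, HC_CM or HC_AV.
-/

namespace Summit.Ventures.HSemireg.CubicFormScaling

variable {k R : Type*} [CommRing k] [Ring R] [Algebra k R]

/-- **Components scale.** If `u' = t • u` and `V' = c • V` then `u'V' + V'u' = (c*t) • (uV + Vu)`. [bookkeeping] -/
theorem component_scaling (u V : R) (t c : k) :
    (t • u) * (c • V) + (c • V) * (t • u) = (c * t) • (u * V + V * u) := by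
  simp only [smul_mul_assoc, mul_smul_comm, smul_smul, smul_add, mul_comm c t]

/-- **One product scales by the full character.** For scalars `x y z : k` and ring elements, `(x•X)(y•Y)(z•Z) = (x*y*z)•(XYZ)`. -/
theorem triple_product_scaling (X Y Z : R) (x y z : k) :
    (x • X) * (y • Y) * (z • Z) = (x * y * z) • (X * Y * Z) := by
  simp only [smul_mul_assoc, mul_smul_comm, smul_smul]
  ring_nf

/-- **The cubic form is a semi-invariant of the diagonal scalings.** With component weights
`β^x_i = s_x * t_{i-1} * t_{i+1}` (class scaling `s_x`, frame scalings `t_1,t_2,t_3`; indices mod 3, written out), the six-term cubic form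
`T(B,C,E) = B₁C₂E₃ + B₂C₃E₁ + B₃C₁E₂ − B₁C₃E₂ − B₃C₂E₁ − B₂C₁E₃` of the scaled components equals
`(s_a s_b s_c (t₁t₂t₃)²) • T(B,C,E)`. (REGIME-CENSUS-t5g24 §6.1; th-3 g36 degeneration lemma (b).) -/
theorem cubic_form_scaling (B1 B2 B3 C1 C2 C3 E1 E2 E3 : R) (sa sb sc t1 t2 t3 : k) :
    ((sa * t2 * t3) • B1) * ((sb * t3 * t1) • C2) * ((sc * t1 * t2) • E3)
      + ((sa * t3 * t1) • B2) * ((sb * t1 * t2) • C3) * ((sc * t2 * t3) • E1)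
      + ((sa * t1 * t2) • B3) * ((sb * t2 * t3) • C1) * ((sc * t3 * t1) • E2)
      - ((sa * t2 * t3) • B1) * ((sb * t1 * t2) • C3) * ((sc * t3 * t1) • E2)
      - ((sa * t1 * t2) • B3) * ((sb * t3 * t1) • C2) * ((sc * t2 * t3) • E1)
      - ((sa * t3 * t1) • B2) * ((sb * t2 * t3) • C1) * ((sc * t1 * t2) • E3)
    = (sa * sb * sc * (t1 * t2 * t3) ^ 2) •
      (B1 * C2 * E3 + B2 * C3 * E1 + B3 * C1 * E2 - B1 * C3 * E2 - B3 * C2 * E1 - B2 * C1 * E3) := by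
  simp only [triple_product_scaling, smul_add, smul_sub]
  have e1 : sa * t2 * t3 * (sb * t3 * t1) * (sc * t1 * t2) = sa * sb * sc * (t1 * t2 * t3) ^ 2 := by ring
  have e2 : sa * t3 * t1 * (sb * t1 * t2) * (sc * t2 * t3) = sa * sb * sc * (t1 * t2 * t3) ^ 2 := by ring
  have e3 : sa * t1 * t2 * (sb * t2 * t3) * (sc * t3 * t1) = sa * sb * sc * (t1 * t2 * t3) ^ 2 := by ring
  have e4 : sa * t2 * t3 * (sb * t1 * t2) * (sc * t3 * t1) = sa * sb * sc * (t1 * t2 * t3) ^ 2 := by ring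
  have e5 : sa * t1 * t2 * (sb * t3 * t1) * (sc * t2 * t3) = sa * sb * sc * (t1 * t2 * t3) ^ 2 := by ring
  have e6 : sa * t3 * t1 * (sb * t2 * t3) * (sc * t1 * t2) = sa * sb * sc * (t1 * t2 * t3) ^ 2 := by ring
  rw [e1, e2, e3, e4, e5, e6]

/-- **A functional sees only the character.** For any `k`-linear `τ` (a level trace, the supertrace), the value of `τ` on the scaled
cubic form is `(s_a s_b s_c (t₁t₂t₃)²) * τ(T)`; in particular if that character value is `1` the functional is unchanged — the
invariance that, together with a contracting one-parameter scaling, forces `τ(T) = 0` in the cell's instability certificates. -/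
theorem functional_cubic_form_scaling (τ : R →ₗ[k] k) (B1 B2 B3 C1 C2 C3 E1 E2 E3 : R) (sa sb sc t1 t2 t3 : k) :
    τ (((sa * t2 * t3) • B1) * ((sb * t3 * t1) • C2) * ((sc * t1 * t2) • E3)
      + ((sa * t3 * t1) • B2) * ((sb * t1 * t2) • C3) * ((sc * t2 * t3) • E1)
      + ((sa * t1 * t2) • B3) * ((sb * t2 * t3) • C1) * ((sc * t3 * t1) • E2)
      - ((sa * t2 * t3) • B1) * ((sb * t1 * t2) • C3) * ((sc * t3 * t1) • E2)
      - ((sa * t1 * t2) • B3) * ((sb * t3 * t1) • C2) * ((sc * t2 * t3) • E1)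
      - ((sa * t3 * t1) • B2) * ((sb * t2 * t3) • C1) * ((sc * t1 * t2) • E3))
    = (sa * sb * sc * (t1 * t2 * t3) ^ 2) *
      τ (B1 * C2 * E3 + B2 * C3 * E1 + B3 * C1 * E2 - B1 * C3 * E2 - B3 * C2 * E1 - B2 * C1 * E3) := by
  rw [cubic_form_scaling, map_smul, smul_eq_mul]

end Summit.Ventures.HSemireg.CubicFormScaling
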